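import Summits.QuantumFields.YangMills.Theorems.DiagonalMirrorRPRDiagonalSliceModelDefs
import Summits.QuantumFields.YangMills.Theorems.PencilRigidityWeakCouplingHypercubicLimitRPSwapPairingPSD
import Summits.QuantumFields.YangMills.Theorems.PencilRigidityDiagonalMirrorRPRStubRpClosureSupport

/-!
# Crux `WeakCouplingHypercubicLimitRP` (stmt-QuantumFields-27398) / aside `DiagonalMirrorRPR` (stmt-QuantumFields-10604), door B,
# construction F1_diag — PAIRING LAYER, step P1′: the MIRRORED family is the family read at the SWAPPED configuration, and the
# Gram pairing is ONE Wilson expectation `⟨(Y ∘ Θ) · Y⟩_k`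

Helper file (`--supports stmt-QuantumFields-27398 --as helper`) of the hand `hand-10604-wilsonDiagModel-2` (docket director-ym g23, O4 WORD
18 (3)(iii) / 20 (1): continue π1′ towards `def wilsonDiagonalModel : DiagonalSliceModel r sch`; steps P1′/P2-entry of hand-1's ROADMAP-F1diag v4
§1⅞) for the registered stub D1 `stub_diagRPOfPlaneLimits` of `Cruxes/WeakCouplingHypercubicLimitRP/Lines/Sketch.lean` (sha16 `7bf38c709623ad77`);
it closes nothing by itself.

WHAT.
* §1 `smearedLatticeField_torusLift_swap` — the POINTWISE swap covariance of the smeared curvature field on the scheme's own torus: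
  `Φ(h ∘ swap₀₁)(Ũ) = Φ(h)((P_swap U)~)` (`Ũ = torusLift S U`; the curvature species is exactly swap covariant at the corner,
  `LatticeRep.curvature_F_perm_torusLift`; the smearing box is swap invariant, `sitePermZd_mem_box_iff`) — the integrand-level form of the
  lead's `latticeSchwinger_swap` (p827142).
* §2 for a reflected family `F` (`σf i j = f i (rev j) ∘ swap₀₁`): `prod_smearedLatticeField_mirror` (`∏_j Φ_k(σf i j)(Ũ) = ∏_j Φ_k(f i j)((P U)~)`,
  re-indexing by `Fin.revPerm`) and `mirrorObs_eq_famObs_swap` (`Σ_i c_i ∏_j Φ_k(σf i j)(Ũ) = Y_k(F)((P U)~)`): the mirrored observable IS the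
  family observable `famObs` read at the swapped configuration — so by P1 (`…WilsonDiagonalModelSlabSupport.exists_famDepth`) and the fibrewise
  swap (`inslab_layerReadU_swap`, `bonds_layerReadU_swap`, hand-1 p825750) it lives in the layers `−d_k, …, 0` of the symmetric chart.
* §3 `measurable_famObs_torusLift`, `exists_abs_famObs_le`, and **`gramPairing_eq_integral_famObs_swap`**:
  `gramPairing r sch F k = ∫ Y_k(F)((P U)~) · Y_k(F)(Ũ) dμ_k(U)` — the Gram pairing of the interface as ONE Wilson expectation of the product of
  the family observable and its swap (`Fin.prod_univ_add` on the appended strings, bilinearity of the integral; every factor is bounded and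
  measurable).  With `integral_wilsonMeasure_eq_diagCyclicU` (hand-1) this is the entry point of the insertion form P2:
  `gramPairing · Tr K_u^S = ∫ (Y∘Θ)(Z) Y(Z) ∏_t K_u(Z_t, Z_{t+1}) dZ` over symmetric-chart layers.

HONEST FRAMING: construction bookkeeping only; `wilsonDiagonalModel` is NOT landed (P2–P4 + assembly remain); no letter is proved; D1, ⟨27398⟩, S6i
and the aside ⟨10604⟩ are OPEN; nothing here bears on the summit; the Yang–Mills mass gap is NOT proved here or anywhere in the tree.  No definition,
no instance, no notation, `autoImplicit false`.

References: K. Osterwalder, E. Seiler, Ann. Phys. 110 (1978) §2–3; E. Seiler, LNP 159 (1982) Ch. 1–2 (hypercubic invariance of Wilson's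
action and measure; reflection of observables).
-/

set_option autoImplicit false

noncomputable section

open scoped SchwartzMap
open MeasureTheory Filter Topology
open Literature.MathematicalPhysics.QuantumLattice Literature.MathematicalPhysics.AQFT
  Literature.MathematicalPhysics.QuantumFieldTheory
open Literature.Probability.LatticeModels (box Site)
open Summit.QuantumFields.YangMills.Cruxes.DiagonalMirrorRPR.ParityBridgeColdTraces (E4)
open Summit.QuantumFields.YangMills.Cruxes.DiagonalMirrorRPR.ParityBridgeColdTraces.RpClosure
  (swap01 siteSwap swap01_smul_siteToE siteSwap_eq_sitePermZd exists_abs_smearedLatticeField_le)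

namespace Summit.QuantumFields.YangMills.Cruxes.DiagonalMirrorRPR.SignTwistedDiagonalTrace.WilsonDiagonal

variable {G : Type} [Group G] [TopologicalSpace G] [IsTopologicalGroup G] [CompactSpace G]
  [MeasurableSpace G] [BorelSpace G] (r : LatticeRep G)

/-! ## §1 Pointwise swap covariance of the smeared curvature field on the own torus -/

/-- **Pointwise swap covariance.**  Smearing the curvature against `h ∘ swap₀₁` at the periodic lift of a torus configuration equals
smearing against `h` at the periodic lift of the SWAPPED configuration: `Φ(h ∘ swap₀₁)(Ũ) = Φ(h)((P_swap U)~)`. -/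
theorem smearedLatticeField_torusLift_swap (S L : ℕ) (a cc m : ℝ) (h h' : 𝓢(E4, ℝ)) (hh' : ∀ x, h' x = h (swap01 x))
    (U : GaugeConfig 4 S G) :
    smearedLatticeField r.curvature.F (box 4 L) a cc m h' (torusLift S U) =
      smearedLatticeField r.curvature.F (box 4 L) a cc m h (torusLift S (configPerm (Equiv.swap (0 : Fin 4) 1) U)) := by
  unfold smearedLatticeField
  congr 1
  refine Finset.sum_nbij' (sitePermZd (Equiv.swap (0 : Fin 4) 1)) (sitePermZd (Equiv.swap (0 : Fin 4) 1))
    (fun x hx => (sitePermZd_mem_box_iff _ _ x).2 hx) (fun x hx => (sitePermZd_mem_box_iff _ _ x).2 hx)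
    (fun x _ => ?_) (fun x _ => ?_) (fun x _ => ?_)
  · funext j; simp [sitePermZd_apply]
  · funext j; simp [sitePermZd_apply]
  · rw [hh', swap01_smul_siteToE, siteSwap_eq_sitePermZd, LatticeRep.curvature_F_perm_torusLift]

/-! ## §2 The mirrored family is the family at the swapped configuration -/

variable (sch : SpeciesScheme (YMSpecies G))

/-- One mirrored product: `∏_j Φ_k(σf i j)(Ũ) = ∏_j Φ_k(f i j)((P_swap U)~)` (pointwise swap covariance factor by factor, then re-indexing the
product by `j ↦ rev j`). -/
theorem prod_smearedLatticeField_mirror (F : ReflectedFamily) (i : Fin F.m) (k : ℕ) (U : GaugeConfig 4 (sch.side k) G) :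
    ∏ j, smearedLatticeField r.curvature.F (box 4 (sch.L k)) (sch.a k) (sch.c r.curvature k) (sch.m r.curvature k) (F.σf i j)
        (torusLift (sch.side k) U) =
      ∏ j, smearedLatticeField r.curvature.F (box 4 (sch.L k)) (sch.a k) (sch.c r.curvature k) (sch.m r.curvature k) (F.f i j)
        (torusLift (sch.side k) (configPerm (Equiv.swap (0 : Fin 4) 1) U)) := by
  have hfac : ∀ j, smearedLatticeField r.curvature.F (box 4 (sch.L k)) (sch.a k) (sch.c r.curvature k) (sch.m r.curvature k)
      (F.σf i j) (torusLift (sch.side k) U) =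
      smearedLatticeField r.curvature.F (box 4 (sch.L k)) (sch.a k) (sch.c r.curvature k) (sch.m r.curvature k) (F.f i (Fin.rev j))
        (torusLift (sch.side k) (configPerm (Equiv.swap (0 : Fin 4) 1) U)) := fun j =>
    smearedLatticeField_torusLift_swap r _ _ _ _ _ (F.f i (Fin.rev j)) (F.σf i j) (F.mirror i j) U
  simp_rw [hfac]
  exact Fintype.prod_equiv Fin.revPerm _ _ fun j => rfl

/-- **The mirrored observable is the family observable at the swapped configuration**:
`Σ_i c_i ∏_j Φ_k(σf i j)(Ũ) = Y_k(F)((P_swap U)~)`. -/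
theorem mirrorObs_eq_famObs_swap (F : ReflectedFamily) (k : ℕ) (U : GaugeConfig 4 (sch.side k) G) :
    ∑ i, F.c i * ∏ j, smearedLatticeField r.curvature.F (box 4 (sch.L k)) (sch.a k) (sch.c r.curvature k) (sch.m r.curvature k)
        (F.σf i j) (torusLift (sch.side k) U) =
      famObs r sch F k (torusLift (sch.side k) (configPerm (Equiv.swap (0 : Fin 4) 1) U)) := by
  unfold famObs
  exact Finset.sum_congr rfl fun i _ => by rw [prod_smearedLatticeField_mirror]

/-! ## §3 The Gram pairing as one Wilson expectation -/

omit [TopologicalSpace G] [IsTopologicalGroup G] [CompactSpace G] [BorelSpace G] in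
/-- A smeared field read at the periodic lift is measurable in the torus configuration. -/
theorem measurable_smearedLatticeField_torusLift' (O : YMSpecies G) (Λ : Finset (Site 4)) (a cc m : ℝ) (h : 𝓢(E4, ℝ)) (S : ℕ) :
    Measurable fun U : GaugeConfig 4 S G => smearedLatticeField O.F Λ a cc m h (torusLift S U) := by
  unfold smearedLatticeField
  refine (Finset.measurable_sum _ fun x _ => ?_).const_mul _
  exact ((O.measurable.comp ((configShift _).measurable.comp (measurable_torusLift _))).sub_const _).const_mul _

/-- The family observable read at the periodic lift is measurable in the torus configuration. -/
theorem measurable_famObs_torusLift (F : ReflectedFamily) (k : ℕ) :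
    Measurable fun U : GaugeConfig 4 (sch.side k) G => famObs r sch F k (torusLift (sch.side k) U) := by
  unfold famObs
  refine Finset.measurable_sum _ fun i _ => ?_
  refine (Finset.measurable_prod _ fun j _ => ?_).const_mul _
  exact measurable_smearedLatticeField_torusLift' r.curvature _ _ _ _ (F.f i j) _

/-- The family observable is bounded (every smeared factor of a bounded observable is). -/
theorem exists_abs_famObs_le (F : ReflectedFamily) (k : ℕ) : ∃ B : ℝ, ∀ V : LGConfig 4 G, |famObs r sch F k V| ≤ B := by
  have hfac : ∀ i j, ∃ C : ℝ, ∀ V : LGConfig 4 G, |smearedLatticeField r.curvature.F (box 4 (sch.L k)) (sch.a k) (sch.c r.curvature k)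
      (sch.m r.curvature k) (F.f i j) V| ≤ C := fun i j =>
    exists_abs_smearedLatticeField_le r.curvature _ _ _ _ (F.f i j)
  choose C hC using hfac
  refine ⟨∑ i, |F.c i| * ∏ j, C i j, fun V => ?_⟩
  unfold famObs
  refine (Finset.abs_sum_le_sum_abs _ _).trans (Finset.sum_le_sum fun i _ => ?_)
  rw [abs_mul, Finset.abs_prod]
  refine mul_le_mul_of_nonneg_left ?_ (abs_nonneg _)
  exact Finset.prod_le_prod (fun j _ => abs_nonneg _) fun j _ => hC i j V

/-- **The Gram pairing as ONE Wilson expectation.**  `gramPairing r sch F k = ∫ Y_k(F)((P_swap U)~) · Y_k(F)(Ũ) dμ_k(U)`: the appended strings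
split the product (`Fin.prod_univ_add`), the mirrored half is the family observable at the swapped configuration (`mirrorObs_eq_famObs_swap`),
and the double sum of expectations is the expectation of the product of the two sums (bounded measurable integrands on a probability space). -/
theorem gramPairing_eq_integral_famObs_swap (F : ReflectedFamily) (k : ℕ) :
    gramPairing r sch F k =
      ∫ U, famObs r sch F k (torusLift (sch.side k) (configPerm (Equiv.swap (0 : Fin 4) 1) U)) *
          famObs r sch F k (torusLift (sch.side k) U) ∂(wilsonMeasure (d := 4) (L := sch.side k) r.ρ (sch.β k)) := by
  haveI := isProbabilityMeasure_wilsonMeasure (d := 4) (L := sch.side k) r.ρ r.continuous (sch.β k)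
  set μ : Measure (GaugeConfig 4 (sch.side k) G) := wilsonMeasure (d := 4) (L := sch.side k) r.ρ (sch.β k) with hμ
  -- abbreviations for the factors
  set A : Fin F.m → GaugeConfig 4 (sch.side k) G → ℝ := fun i U =>
    ∏ j, smearedLatticeField r.curvature.F (box 4 (sch.L k)) (sch.a k) (sch.c r.curvature k) (sch.m r.curvature k) (F.σf i j)
      (torusLift (sch.side k) U) with hA
  set B : Fin F.m → GaugeConfig 4 (sch.side k) G → ℝ := fun i U =>
    ∏ j, smearedLatticeField r.curvature.F (box 4 (sch.L k)) (sch.a k) (sch.c r.curvature k) (sch.m r.curvature k) (F.f i j)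
      (torusLift (sch.side k) U) with hB
  -- measurability and bounds
  have hAm : ∀ i, Measurable (A i) := fun i =>
    Finset.measurable_prod _ fun j _ => measurable_smearedLatticeField_torusLift' r.curvature _ _ _ _ (F.σf i j) _
  have hBm : ∀ i, Measurable (B i) := fun i =>
    Finset.measurable_prod _ fun j _ => measurable_smearedLatticeField_torusLift' r.curvature _ _ _ _ (F.f i j) _
  have hAb : ∀ i, ∃ C : ℝ, ∀ U, |A i U| ≤ C := by
    intro i
    have hfac : ∀ j, ∃ C : ℝ, ∀ V : LGConfig 4 G, |smearedLatticeField r.curvature.F (box 4 (sch.L k)) (sch.a k)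
        (sch.c r.curvature k) (sch.m r.curvature k) (F.σf i j) V| ≤ C := fun j =>
      exists_abs_smearedLatticeField_le r.curvature _ _ _ _ (F.σf i j)
    choose C hC using hfac
    refine ⟨∏ j, C j, fun U => ?_⟩
    rw [hA]; dsimp only
    rw [Finset.abs_prod]
    exact Finset.prod_le_prod (fun j _ => abs_nonneg _) fun j _ => hC j _
  have hBb : ∀ i, ∃ C : ℝ, ∀ U, |B i U| ≤ C := by
    intro i
    have hfac : ∀ j, ∃ C : ℝ, ∀ V : LGConfig 4 G, |smearedLatticeField r.curvature.F (box 4 (sch.L k)) (sch.a k)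
        (sch.c r.curvature k) (sch.m r.curvature k) (F.f i j) V| ≤ C := fun j =>
      exists_abs_smearedLatticeField_le r.curvature _ _ _ _ (F.f i j)
    choose C hC using hfac
    refine ⟨∏ j, C j, fun U => ?_⟩
    rw [hB]; dsimp only
    rw [Finset.abs_prod]
    exact Finset.prod_le_prod (fun j _ => abs_nonneg _) fun j _ => hC j _
  have hint : ∀ i i', Integrable (fun U => A i U * B i' U) μ := by
    intro i i'
    obtain ⟨C, hC⟩ := hAb i
    obtain ⟨C', hC'⟩ := hBb i'
    refine Integrable.of_bound (C := C * C') ((hAm i).mul (hBm i')).aestronglyMeasurable (Eventually.of_forall fun U => ?_)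
    rw [Real.norm_eq_abs, abs_mul]
    exact mul_le_mul (hC U) (hC' U) (abs_nonneg _) ((abs_nonneg _).trans (hC U))
  -- the appended product splits
  have hsplit : ∀ i i', latticeSchwinger r.ρ sch (fun s => s.F) k (F.n i + F.n i') (fun _ => r.curvature) (Fin.append (F.σf i) (F.f i')) =
      ∫ U, A i U * B i' U ∂μ := by
    intro i i'
    unfold latticeSchwinger
    refine integral_congr_ae (Eventually.of_forall fun U => ?_)
    dsimp only
    rw [Fin.prod_univ_add]
    simp only [Fin.append_left, Fin.append_right, hA, hB]
  -- assemble
  calc gramPairing r sch F k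
      = ∑ i, ∑ i', F.c i * F.c i' * ∫ U, A i U * B i' U ∂μ := by
        unfold gramPairing
        exact Finset.sum_congr rfl fun i _ => Finset.sum_congr rfl fun i' _ => by rw [hsplit]
    _ = ∑ i, ∑ i', ∫ U, F.c i * F.c i' * (A i U * B i' U) ∂μ := by
        refine Finset.sum_congr rfl fun i _ => Finset.sum_congr rfl fun i' _ => ?_
        rw [integral_const_mul]
    _ = ∫ U, ∑ i, ∑ i', F.c i * F.c i' * (A i U * B i' U) ∂μ := by
        rw [integral_finsetSum _ fun i _ => integrable_finsetSum _ fun i' _ => (hint i i').const_mul _]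
        exact Finset.sum_congr rfl fun i _ => (integral_finsetSum _ fun i' _ => (hint i i').const_mul _).symm
    _ = ∫ U, (∑ i, F.c i * A i U) * (∑ i', F.c i' * B i' U) ∂μ := by
        refine integral_congr_ae (Eventually.of_forall fun U => ?_)
        dsimp only
        rw [Finset.sum_mul_sum]
        exact Finset.sum_congr rfl fun i _ => Finset.sum_congr rfl fun i' _ => by ring
    _ = ∫ U, famObs r sch F k (torusLift (sch.side k) (configPerm (Equiv.swap (0 : Fin 4) 1) U)) *
          famObs r sch F k (torusLift (sch.side k) U) ∂μ := by
        refine integral_congr_ae (Eventually.of_forall fun U => ?_)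
        dsimp only
        rw [← mirrorObs_eq_famObs_swap r sch F k U]
        rfl

end Summit.QuantumFields.YangMills.Cruxes.DiagonalMirrorRPR.SignTwistedDiagonalTrace.WilsonDiagonal

end
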